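import Summits.ABC.ABC.Theorems.IneffectiveSubspaceDepthCountedABCStubCellZeroQuarticThue

/-!
# Stub `stub_cellZeroSparseExceptions` of line `Sketch` — crux `DepthCountedABC` (stmt-ABC-14938)

WHAT.  The cell-0 exceptions to exponent `2 − δ` are power-sparse: for `0 < δ ≤ 1` there is `C` (here
`C = 1156`) such that for every `N`, any finite set of 5-free abc triples `(a, b, c)`
(`#{p : v_p(abc) ≥ 5} = 0`) with `c ≤ N` and `rad(abc)^(2−δ) ≤ c` has at most `C·N^(1/4 + 16δ)` elements —
against `≍ N²` triples in the cell.  Unconditional and uniform in `N`; it is the trivial count that a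
uniform quartic Thue bound (crux #4) would improve to `N^(O(δ))`.

MECHANISM (elementary counting).  Order the triple `a ≤ b`; `quarticThue_natBounds` writes `c = v·Z⁴` with
`a·u·v·c⁸ ≤ 16·rad¹⁶`.  From `rad^(2−δ) ≤ c` and `rad ≥ 1`: `rad^((2−δ)·8) ≤ c⁸` and `rad ≤ c`, so
`a·u·v ≤ 16·rad^(8δ) ≤ 16·c^(8δ) ≤ 16·N^(8δ)`; hence `a, v ≤ A := ⌊16·N^(8δ)⌋`, and `Z⁴ ≤ vZ⁴ = c ≤ N`
gives `Z ≤ W := ⌊N^(1/4)⌋`.  The pair `(a, c)` determines the triple (`b = c − a`), and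
`(a, c) = (a, v·Z⁴)` lies in the box `[0, A] × {v·Z⁴ : v ≤ A, Z ≤ W}` of size `≤ (A+1)²(W+1)`; the
ordering `b < a` symmetrically with the pair `(b, c)`.  So `#T ≤ 2(A+1)²(W+1) ≤ 2·(17N^(8δ))²·2N^(1/4)
= 1156·N^(1/4+16δ)` for `N ≥ 1` (and `T = ∅` for `N = 0`).

Sources: skeleton `Cruxes/DepthCountedABC/Lines/Sketch.lean` (lead c23, wave 2), stub
`stub_cellZeroSparseExceptions`.  Ingredients: `quarticThue_natBounds`
(`…StubCellZeroQuarticThue`), `calibration_fiveFree_of_card_eq_zero` (`…StubCalibration`),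
`Literature.NumberTheory.DiophantineGeometry.rad_def`; otherwise Mathlib only
(`Finset.card_le_card_of_injOn`, `Finset.card_filter_add_card_filter_not`, `Nat.le_floor`,
`Nat.floor_le`, `Real.rpow_add` / `Real.rpow_mul` / `Real.rpow_le_rpow`).  No unproved facts.
Deliberately NOT here: any improvement of the exponent `1/4 + 16δ` (that is uniform quartic Thue, crux #4),
and the other cells.
-/

-- `Summit.<Summit>.<Problem>` is the mandated summit-side namespace (CONVENTIONS §2); for the
-- single-conjunct summit `ABC` the two coincide, so the duplicate `ABC.ABC` is deliberate.
set_option linter.dupNamespace false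

namespace Summit.ABC.ABC.Theorems.DepthCountedABC

section CellZeroSparse
open UniqueFactorizationMonoid (radical)
open Literature.NumberTheory.DiophantineGeometry (IsABCTriple rad rad_def)

/-- The real-analysis step of the count: from `m·c⁸ ≤ 16·R¹⁶`, `R ≥ 1`, `c ≥ 1` and `R^(2−δ) ≤ c`
(`0 < δ ≤ 1`) one gets `m ≤ 16·c^(8δ)` (`R^((2−δ)·8) ≤ c⁸` and `R ≤ c`). [folklore] -/
theorem cellZeroSparse_le_of_exc {δ : ℝ} (hδ : 0 < δ) (hδ1 : δ ≤ 1) {m c R : ℕ} (hR : 1 ≤ R)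
    (hc : 0 < c) (hF5 : m * c ^ 8 ≤ 16 * R ^ 16) (hexc : (R : ℝ) ^ (2 - δ) ≤ (c : ℝ)) :
    (m : ℝ) ≤ 16 * (c : ℝ) ^ (8 * δ) := by
  have hx1 : (1 : ℝ) ≤ (R : ℝ) := by exact_mod_cast hR
  have hx0 : (0 : ℝ) < (R : ℝ) := by linarith
  have hcpos : (0 : ℝ) < (c : ℝ) := by exact_mod_cast hc
  have hF5R : (m : ℝ) * (c : ℝ) ^ 8 ≤ 16 * (R : ℝ) ^ 16 := by exact_mod_cast hF5
  have hexc8 : (R : ℝ) ^ ((2 - δ) * 8) ≤ (c : ℝ) ^ 8 := by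
    rw [Real.rpow_mul hx0.le, Real.rpow_ofNat]
    exact pow_le_pow_left₀ (Real.rpow_nonneg hx0.le _) hexc 8
  have hRc : (R : ℝ) ≤ (c : ℝ) :=
    calc (R : ℝ) = (R : ℝ) ^ (1 : ℝ) := (Real.rpow_one _).symm
      _ ≤ (R : ℝ) ^ (2 - δ) := Real.rpow_le_rpow_of_exponent_le hx1 (by linarith)
      _ ≤ (c : ℝ) := hexc
  have hc8pos : (0 : ℝ) < (c : ℝ) ^ 8 := by positivity
  have h1 : (m : ℝ) ≤ 16 * (R : ℝ) ^ 16 / (c : ℝ) ^ 8 := by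
    rw [le_div_iff₀ hc8pos]; exact hF5R
  have h2 : 16 * (R : ℝ) ^ 16 / (c : ℝ) ^ 8 ≤ 16 * (R : ℝ) ^ 16 / (R : ℝ) ^ ((2 - δ) * 8) :=
    div_le_div_of_nonneg_left (by positivity) (Real.rpow_pos_of_pos hx0 _) hexc8
  have h3 : 16 * (R : ℝ) ^ 16 / (R : ℝ) ^ ((2 - δ) * 8) = 16 * (R : ℝ) ^ (8 * δ) := by
    have : (R : ℝ) ^ (16 : ℕ) = (R : ℝ) ^ ((2 - δ) * 8) * (R : ℝ) ^ (8 * δ) := by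
      rw [← Real.rpow_add hx0]
      have he : (2 - δ) * 8 + 8 * δ = ((16 : ℕ) : ℝ) := by push_cast; ring
      rw [he, Real.rpow_natCast]
    rw [this]
    have hne : (R : ℝ) ^ ((2 - δ) * 8) ≠ 0 := (Real.rpow_pos_of_pos hx0 _).ne'
    field_simp
  have h4 : (R : ℝ) ^ (8 * δ) ≤ (c : ℝ) ^ (8 * δ) := Real.rpow_le_rpow hx0.le hRc (by positivity)
  linarith [h1, h2, h3.le, h4]

/-- KEY LEMMA of the count.  For a 5-free abc triple ordered `a ≤ b` with `c ≤ N` and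
`rad(abc)^(2−δ) ≤ c` (`0 < δ ≤ 1`): `a ≤ ⌊16·N^(8δ)⌋` and `c = v·Z⁴` with `v ≤ ⌊16·N^(8δ)⌋`,
`Z ≤ ⌊N^(1/4)⌋` (via `quarticThue_natBounds`: `a·u·v ≤ 16·c^(8δ) ≤ 16·N^(8δ)`, `Z⁴ ≤ c ≤ N`). [folklore] -/
theorem cellZeroSparse_data_bounds {δ : ℝ} (hδ : 0 < δ) (hδ1 : δ ≤ 1) {N a b c : ℕ}
    (h : IsABCTriple a b c) (hab : a ≤ b)
    (h0 : ((a * b * c).primeFactors.filter (fun p => 5 ≤ (a * b * c).factorization p)).card = 0)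
    (hcN : c ≤ N) (hexc : ((rad a b c : ℕ) : ℝ) ^ (2 - δ) ≤ (c : ℝ)) :
    a ≤ ⌊16 * (N : ℝ) ^ (8 * δ)⌋₊ ∧
      ∃ v Z : ℕ, c = v * Z ^ 4 ∧ v ≤ ⌊16 * (N : ℝ) ^ (8 * δ)⌋₊ ∧ Z ≤ ⌊(N : ℝ) ^ ((1 : ℝ) / 4)⌋₊ := by
  have h4 : ∀ p ∈ (a * b * c).primeFactors, (a * b * c).factorization p ≤ 4 :=
    calibration_fiveFree_of_card_eq_zero h0
  obtain ⟨u, v, Y, Z, -, hcvZ, hu, hv, -, hZ, hF5, -, -⟩ := quarticThue_natBounds h hab h4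
  obtain ⟨ha, hb, hsum, -⟩ := h
  have hc : 0 < c := by omega
  have hR : 1 ≤ rad a b c := by rw [rad_def]; exact Nat.radical_pos _
  have hauv : ((a * u * v : ℕ) : ℝ) ≤ 16 * (c : ℝ) ^ (8 * δ) :=
    cellZeroSparse_le_of_exc hδ hδ1 hR hc hF5 hexc
  have hcNR : (c : ℝ) ≤ (N : ℝ) := by exact_mod_cast hcN
  have hc0 : (0 : ℝ) ≤ (c : ℝ) := by positivity
  have hcN' : (c : ℝ) ^ (8 * δ) ≤ (N : ℝ) ^ (8 * δ) := Real.rpow_le_rpow hc0 hcNR (by positivity)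
  have hauvN : ((a * u * v : ℕ) : ℝ) ≤ 16 * (N : ℝ) ^ (8 * δ) := by linarith
  have h1 : (a : ℝ) ≤ ((a * u * v : ℕ) : ℝ) := by
    have : a ≤ a * u * v := by
      rw [mul_assoc]; exact Nat.le_mul_of_pos_right a (by positivity)
    exact_mod_cast this
  have h2 : (v : ℝ) ≤ ((a * u * v : ℕ) : ℝ) := by
    have : v ≤ a * u * v := Nat.le_mul_of_pos_left v (by positivity)
    exact_mod_cast this
  have haR : (a : ℝ) ≤ 16 * (N : ℝ) ^ (8 * δ) := h1.trans hauvN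
  have hvR : (v : ℝ) ≤ 16 * (N : ℝ) ^ (8 * δ) := h2.trans hauvN
  have hZR : (Z : ℝ) ≤ (N : ℝ) ^ ((1 : ℝ) / 4) := by
    have hZ4 : Z ^ 4 ≤ N :=
      calc Z ^ 4 = 1 * Z ^ 4 := (one_mul _).symm
        _ ≤ v * Z ^ 4 := Nat.mul_le_mul_right _ hv
        _ = c := hcvZ.symm
        _ ≤ N := hcN
    have hZ4R : (Z : ℝ) ^ 4 ≤ (N : ℝ) := by exact_mod_cast hZ4
    have hZ0 : (0 : ℝ) ≤ (Z : ℝ) := by positivity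
    have h3 : ((Z : ℝ) ^ 4) ^ ((1 : ℝ) / 4) ≤ (N : ℝ) ^ ((1 : ℝ) / 4) :=
      Real.rpow_le_rpow (by positivity) hZ4R (by positivity)
    have h4' : ((Z : ℝ) ^ 4) ^ ((1 : ℝ) / 4) = (Z : ℝ) := by
      rw [← Real.rpow_natCast, ← Real.rpow_mul hZ0]
      have he : ((4 : ℕ) : ℝ) * ((1 : ℝ) / 4) = 1 := by push_cast; ring
      rw [he, Real.rpow_one]
    rw [h4'] at h3; exact h3
  exact ⟨Nat.le_floor haR, v, Z, hcvZ, Nat.le_floor hvR, Nat.le_floor hZR⟩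

/-- An abc triple is determined by `(a, c)`: `t ↦ (t.1, t.2.2)` is injective on any finite set of
triples with `t.1 + t.2.1 = t.2.2`. [folklore] -/
theorem cellZeroSparse_injOn_fst {S : Finset (ℕ × ℕ × ℕ)} (hS : ∀ t ∈ S, t.1 + t.2.1 = t.2.2) :
    Set.InjOn (fun t : ℕ × ℕ × ℕ => (t.1, t.2.2)) (S : Set (ℕ × ℕ × ℕ)) := by
  intro t ht t' ht' heq
  have h := hS t (Finset.mem_coe.mp ht)
  have h' := hS t' (Finset.mem_coe.mp ht')
  simp only [Prod.mk.injEq] at heq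
  obtain ⟨h1, h2⟩ := heq
  refine Prod.ext h1 (Prod.ext ?_ h2)
  omega

/-- An abc triple is determined by `(b, c)`: `t ↦ (t.2.1, t.2.2)` is injective on any finite set of
triples with `t.1 + t.2.1 = t.2.2`. [folklore] -/
theorem cellZeroSparse_injOn_snd {S : Finset (ℕ × ℕ × ℕ)} (hS : ∀ t ∈ S, t.1 + t.2.1 = t.2.2) :
    Set.InjOn (fun t : ℕ × ℕ × ℕ => (t.2.1, t.2.2)) (S : Set (ℕ × ℕ × ℕ)) := by
  intro t ht t' ht' heq
  have h := hS t (Finset.mem_coe.mp ht)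
  have h' := hS t' (Finset.mem_coe.mp ht')
  simp only [Prod.mk.injEq] at heq
  obtain ⟨h1, h2⟩ := heq
  refine Prod.ext ?_ (Prod.ext h1 h2)
  omega

/-- The box count: if `f` is injective on `S` and sends every `t ∈ S` to a pair `(x, v·Z⁴)` with
`x ≤ A`, `v ≤ A`, `Z ≤ W`, then `#S ≤ (A+1)·((A+1)·(W+1))` (inject into
`[0, A] × image of [0, A] × [0, W]`). [folklore] -/
theorem cellZeroSparse_card_le_box {S : Finset (ℕ × ℕ × ℕ)} (f : ℕ × ℕ × ℕ → ℕ × ℕ) {A W : ℕ}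
    (hf : ∀ t ∈ S, (f t).1 ≤ A ∧ ∃ v Z : ℕ, (f t).2 = v * Z ^ 4 ∧ v ≤ A ∧ Z ≤ W)
    (hinj : Set.InjOn f (S : Set (ℕ × ℕ × ℕ))) :
    S.card ≤ (A + 1) * ((A + 1) * (W + 1)) := by
  classical
  calc S.card ≤ ((Finset.range (A + 1)) ×ˢ (((Finset.range (A + 1)) ×ˢ (Finset.range (W + 1))).image
          (fun q : ℕ × ℕ => q.1 * q.2 ^ 4))).card := by
        refine Finset.card_le_card_of_injOn f ?_ hinj
        intro t ht
        obtain ⟨h1, v, Z, h2, hv, hZ⟩ := hf t (Finset.mem_coe.mp ht)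
        rw [Finset.mem_coe, Finset.mem_product, Finset.mem_image]
        exact ⟨Finset.mem_range.mpr (by omega), (v, Z),
          Finset.mk_mem_product (Finset.mem_range.mpr (by omega)) (Finset.mem_range.mpr (by omega)),
          h2.symm⟩
    _ = (A + 1) * (((Finset.range (A + 1)) ×ˢ (Finset.range (W + 1))).image
          (fun q : ℕ × ℕ => q.1 * q.2 ^ 4)).card := by
        rw [Finset.card_product, Finset.card_range]
    _ ≤ (A + 1) * ((Finset.range (A + 1)) ×ˢ (Finset.range (W + 1))).card :=
        Nat.mul_le_mul_left _ Finset.card_image_le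
    _ = (A + 1) * ((A + 1) * (W + 1)) := by
        rw [Finset.card_product, Finset.card_range, Finset.card_range]

/-- THE COUNT (natural-number form).  A finite set of 5-free abc triples with `c ≤ N` and
`rad(abc)^(2−δ) ≤ c` has at most `2(A+1)²(W+1)` elements, `A = ⌊16·N^(8δ)⌋`, `W = ⌊N^(1/4)⌋`: split by
the ordering `a ≤ b` / `b < a` and inject each half by `(a, c)` / `(b, c)` into the box. [folklore] -/
theorem cellZeroSparse_count {δ : ℝ} (hδ : 0 < δ) (hδ1 : δ ≤ 1) {N : ℕ} {T : Finset (ℕ × ℕ × ℕ)}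
    (hT : ∀ t ∈ T, IsABCTriple t.1 t.2.1 t.2.2 ∧
        ((t.1 * t.2.1 * t.2.2).primeFactors.filter
            (fun p => 5 ≤ (t.1 * t.2.1 * t.2.2).factorization p)).card = 0 ∧
        t.2.2 ≤ N ∧ ((rad t.1 t.2.1 t.2.2 : ℕ) : ℝ) ^ (2 - δ) ≤ (t.2.2 : ℝ)) :
    T.card ≤ 2 * ((⌊16 * (N : ℝ) ^ (8 * δ)⌋₊ + 1) *
      ((⌊16 * (N : ℝ) ^ (8 * δ)⌋₊ + 1) * (⌊(N : ℝ) ^ ((1 : ℝ) / 4)⌋₊ + 1))) := by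
  generalize hA : ⌊16 * (N : ℝ) ^ (8 * δ)⌋₊ = A
  generalize hW : ⌊(N : ℝ) ^ ((1 : ℝ) / 4)⌋₊ = W
  -- the half `a ≤ b`, injected by `(a, c)`
  have h₁ : (T.filter (fun t => t.1 ≤ t.2.1)).card ≤ (A + 1) * ((A + 1) * (W + 1)) := by
    refine cellZeroSparse_card_le_box (fun t => (t.1, t.2.2)) ?_ ?_
    · intro t ht
      obtain ⟨htT, hab⟩ := Finset.mem_filter.mp ht
      obtain ⟨habc, h0, hcN, hexc⟩ := hT t htT
      obtain ⟨ha, v, Z, hc, hv, hZ⟩ := cellZeroSparse_data_bounds hδ hδ1 habc hab h0 hcN hexc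
      rw [hA] at ha hv
      rw [hW] at hZ
      exact ⟨ha, v, Z, hc, hv, hZ⟩
    · exact cellZeroSparse_injOn_fst (fun t ht => (hT t (Finset.mem_filter.mp ht).1).1.2.2.1)
  -- the half `b < a`, injected by `(b, c)` (the data of the swapped triple `(b, a, c)`)
  have h₂ : (T.filter (fun t => ¬ t.1 ≤ t.2.1)).card ≤ (A + 1) * ((A + 1) * (W + 1)) := by
    refine cellZeroSparse_card_le_box (fun t => (t.2.1, t.2.2)) ?_ ?_
    · intro t ht
      obtain ⟨htT, hab⟩ := Finset.mem_filter.mp ht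
      obtain ⟨habc, h0, hcN, hexc⟩ := hT t htT
      have hsw : IsABCTriple t.2.1 t.1 t.2.2 :=
        ⟨habc.2.1, habc.1, by rw [add_comm]; exact habc.2.2.1, habc.2.2.2.symm⟩
      have hprod : t.2.1 * t.1 * t.2.2 = t.1 * t.2.1 * t.2.2 := by ring
      have h0' : ((t.2.1 * t.1 * t.2.2).primeFactors.filter
          (fun p => 5 ≤ (t.2.1 * t.1 * t.2.2).factorization p)).card = 0 := by
        rw [hprod]; exact h0
      have hexc' : ((rad t.2.1 t.1 t.2.2 : ℕ) : ℝ) ^ (2 - δ) ≤ (t.2.2 : ℝ) := by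
        rw [rad_def, hprod, ← rad_def]; exact hexc
      obtain ⟨hb, v, Z, hc, hv, hZ⟩ :=
        cellZeroSparse_data_bounds hδ hδ1 hsw (not_le.mp hab).le h0' hcN hexc'
      rw [hA] at hb hv
      rw [hW] at hZ
      exact ⟨hb, v, Z, hc, hv, hZ⟩
    · exact cellZeroSparse_injOn_snd (fun t ht => (hT t (Finset.mem_filter.mp ht).1).1.2.2.1)
  calc T.card
      = (T.filter (fun t => t.1 ≤ t.2.1)).card + (T.filter (fun t => ¬ t.1 ≤ t.2.1)).card :=
        (Finset.card_filter_add_card_filter_not _).symm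
    _ ≤ (A + 1) * ((A + 1) * (W + 1)) + (A + 1) * ((A + 1) * (W + 1)) := Nat.add_le_add h₁ h₂
    _ = 2 * ((A + 1) * ((A + 1) * (W + 1))) := by ring

/-- FINAL ARITHMETIC.  For `N ≥ 1`: `2(A+1)²(W+1) ≤ 1156·N^(1/4 + 16δ)` with `A = ⌊16·N^(8δ)⌋`,
`W = ⌊N^(1/4)⌋` (`A + 1 ≤ 17·N^(8δ)`, `W + 1 ≤ 2·N^(1/4)`, `(N^(8δ))² · N^(1/4) = N^(1/4+16δ)`). [folklore] -/
theorem cellZeroSparse_final_arith {δ : ℝ} (hδ : 0 < δ) {N : ℕ} (hN : 0 < N) :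
    (2 : ℝ) * ((⌊16 * (N : ℝ) ^ (8 * δ)⌋₊ : ℝ) + 1) ^ 2 * ((⌊(N : ℝ) ^ ((1 : ℝ) / 4)⌋₊ : ℝ) + 1) ≤
      1156 * (N : ℝ) ^ ((1 : ℝ) / 4 + 16 * δ) := by
  have hN1 : (1 : ℝ) ≤ (N : ℝ) := by exact_mod_cast hN
  have hN0 : (0 : ℝ) < (N : ℝ) := by linarith
  have hx1 : (1 : ℝ) ≤ (N : ℝ) ^ (8 * δ) := Real.one_le_rpow hN1 (by positivity)
  have hy1 : (1 : ℝ) ≤ (N : ℝ) ^ ((1 : ℝ) / 4) := Real.one_le_rpow hN1 (by positivity)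
  have hA : ((⌊16 * (N : ℝ) ^ (8 * δ)⌋₊ : ℕ) : ℝ) ≤ 16 * (N : ℝ) ^ (8 * δ) :=
    Nat.floor_le (by positivity)
  have hW : ((⌊(N : ℝ) ^ ((1 : ℝ) / 4)⌋₊ : ℕ) : ℝ) ≤ (N : ℝ) ^ ((1 : ℝ) / 4) :=
    Nat.floor_le (by positivity)
  have hA1 : ((⌊16 * (N : ℝ) ^ (8 * δ)⌋₊ : ℕ) : ℝ) + 1 ≤ 17 * (N : ℝ) ^ (8 * δ) := by linarith
  have hW1 : ((⌊(N : ℝ) ^ ((1 : ℝ) / 4)⌋₊ : ℕ) : ℝ) + 1 ≤ 2 * (N : ℝ) ^ ((1 : ℝ) / 4) := by linarith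
  have hsq : ((N : ℝ) ^ (8 * δ)) ^ 2 = (N : ℝ) ^ (16 * δ) := by
    rw [← Real.rpow_natCast, ← Real.rpow_mul hN0.le]
    congr 1
    push_cast
    ring
  have hrhs : (N : ℝ) ^ ((1 : ℝ) / 4 + 16 * δ) = (N : ℝ) ^ ((1 : ℝ) / 4) * ((N : ℝ) ^ (8 * δ)) ^ 2 := by
    rw [Real.rpow_add hN0, hsq]
  rw [hrhs]
  calc (2 : ℝ) * ((⌊16 * (N : ℝ) ^ (8 * δ)⌋₊ : ℝ) + 1) ^ 2 * ((⌊(N : ℝ) ^ ((1 : ℝ) / 4)⌋₊ : ℝ) + 1)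
      ≤ 2 * (17 * (N : ℝ) ^ (8 * δ)) ^ 2 * (2 * (N : ℝ) ^ ((1 : ℝ) / 4)) := by gcongr
    _ = 1156 * ((N : ℝ) ^ ((1 : ℝ) / 4) * ((N : ℝ) ^ (8 * δ)) ^ 2) := by ring

end CellZeroSparse

open Literature.NumberTheory.DiophantineGeometry (IsABCTriple rad rad_def) in
/-- **Stub `stub_cellZeroSparseExceptions` (the cell-0 exceptions to `2 − δ` are power-sparse) of line
`Sketch`, crux `DepthCountedABC` (stmt-ABC-14938):** for `0 < δ ≤ 1` there is `C` such that for every `N`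
any finite set of 5-free abc triples with `c ≤ N` and `rad(abc)^(2−δ) ≤ c` has at most `C·N^(1/4 + 16δ)`
elements: ordered `a ≤ b`, `quarticThue_natBounds` gives `c = vZ⁴` with
`a·u·v·c⁸ ≤ 16·rad¹⁶`, so `a, v ≤ 16·N^(8δ)` and `Z ≤ N^(1/4)`, and `(a, c)` determines the triple;
the ordering `b < a` symmetrically.  Unconditional and uniform. [folklore] -/
theorem stub_cellZeroSparseExceptions : ∀ δ : ℝ, 0 < δ → δ ≤ 1 → ∃ C : ℝ, 0 < C ∧ ∀ N : ℕ,
    ∀ T : Finset (ℕ × ℕ × ℕ),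
      (∀ t ∈ T, Literature.NumberTheory.DiophantineGeometry.IsABCTriple t.1 t.2.1 t.2.2 ∧
        ((t.1 * t.2.1 * t.2.2).primeFactors.filter
            (fun p => 5 ≤ (t.1 * t.2.1 * t.2.2).factorization p)).card = 0 ∧
        t.2.2 ≤ N ∧
        ((Literature.NumberTheory.DiophantineGeometry.rad t.1 t.2.1 t.2.2 : ℕ) : ℝ) ^ (2 - δ) ≤ (t.2.2 : ℝ)) →
      (T.card : ℝ) ≤ C * (N : ℝ) ^ ((1 : ℝ) / 4 + 16 * δ) := by
  intro δ hδ hδ1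
  refine ⟨1156, by norm_num, ?_⟩
  intro N T hT
  rcases Nat.eq_zero_or_pos N with hN0 | hNpos
  · -- `N = 0`: no abc triple has `c ≤ 0`, so `T = ∅`
    have hsub : T ⊆ ∅ := by
      intro t ht
      obtain ⟨⟨ha, hb, hsum, -⟩, -, hcN, -⟩ := hT t ht
      exfalso
      omega
    rw [Finset.subset_empty.mp hsub, Finset.card_empty, Nat.cast_zero]
    positivity
  · -- `N ≥ 1`: the count, then the final arithmetic
    have hcount := cellZeroSparse_count hδ hδ1 hT
    have hcast : (T.card : ℝ) ≤ (2 : ℝ) * ((⌊16 * (N : ℝ) ^ (8 * δ)⌋₊ : ℝ) + 1) ^ 2 *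
        ((⌊(N : ℝ) ^ ((1 : ℝ) / 4)⌋₊ : ℝ) + 1) := by
      have h := (Nat.cast_le (α := ℝ)).mpr hcount
      refine h.trans (le_of_eq ?_)
      push_cast
      ring
    exact hcast.trans (cellZeroSparse_final_arith hδ hNpos)

end Summit.ABC.ABC.Theorems.DepthCountedABC
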